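import Summits.Ventures.LatticeQCDFlow.Exactness.IMHCommonRandomNumbersMeetingTimeTotal
import Summits.Ventures.LatticeQCDFlow.Scoring.ReplicaChains
import HarnessLib

/-!
# The printed mean meeting time of `R` coupled pairs estimates `E[T]` — and from (cold, hot) the inverse acceptance `W = 1/A` itself:
# `E(T̄_R − E T)² ≤ p₀W(2W − 1)/R`, Chebyshev, and `T̄_R → E T` almost surely

HONEST FRAMING: exact (Metropolis-corrected) sampling algorithms for lattice gauge theory;
figures of merit are autocorrelation/cost numbers at stated couplings and volumes; no
continuum-physics claim.

Venture `LatticeQCDFlow` (cell pub-lqcd), topic `Exactness`; FANOUT row 30 (lean-1, GEN-39).  NEW WORK of the cell; sequel to GEN-38's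
`…MeetingTimeTotal` (`T = Σ_n 1{X_n ≠ X′_n}` is square integrable on the pair path law, `E[T] ≤ p₀W`, `E[T²] ≤ p₀W(2W − 1)`, `E[T] = W` from
(cold, off-mode)) and to this generation's `…MeetingTimeAnyCoupling` (`E[T] = E[1/A(heavier start); X_0 ≠ X′_0]` from every coupling).  Here `R`
pair streams `Z_0, …, Z_{R−1}` on `(Ω', μ)`, each distributed as the pair chain from ONE initial coupling `ν̂` (`p₀ = ν̂(Δᶜ)`), and the PRINTED
MEAN MEETING TIME `T̄_R = R⁻¹Σ_{j<R} T(Z_j)` (`replicaMean` of the tree's `Scoring/ReplicaError`):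

* §1 (bookkeeping) **`crn_chain_totalDisagreement_aestronglyMeasurable`**, **`crn_chain_totalDisagreement_memLp_two`** — `T ∈ L²(P̂)`;
  **`totalDisagreement_replicas_aestronglyMeasurable`**, **`memLp_totalDisagreement_replica`**, **`totalDisagreement_replicas_identDistrib`**,
  **`totalDisagreement_replicas_indepFun`** — transfer along the streams' common law; pairwise independence from that of the streams.
* §2 **`replicas_meetingTime_sq_le`** — pairwise independent streams, `R ≥ 1`: `E(T̄_R − E T)² ≤ p₀W(2W − 1)/R`;
  **`replicas_meetingTime_chebyshev`** — `P(|T̄_R − E T| ≥ s) ≤ p₀W(2W − 1)/(R s²)`.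
* §3 **`replicas_meetingTime_strongLaw`** — `T̄_R → E T` almost surely (Mathlib's strong law applied);
  **`replicas_meetingTime_strongLaw_cold`** — from (cold, off-mode) with an atom-free proposal `T̄_R → W = 1/A` almost surely: THE OBSERVED MEAN
  MEETING TIME OF COUPLED COLD/HOT PAIRS IS A CONSISTENT ESTIMATOR OF THE INVERSE COLD ACCEPTANCE — the sampler's key figure read off the coupling.
Reading (gauge files): the average number of updates on which `R` coupled pairs of two exact gauge samplers differ converges to its mean, which is `1/A`
from (cold, hot), with mean-square error `≤ (1/A)(2/A − 1)/R`.
NOT CLAIMED: a CLT for `T̄_R`; the exact variance of `T` from a general coupling; any value of `A`.  No `sorry`, no new definitions, nothing cited as a fact.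
-/

noncomputable section

namespace Summit.Ventures.LatticeQCDFlow.Exactness

open MeasureTheory ProbabilityTheory Function Finset Filter
open scoped ENNReal unitInterval Topology
open Summit.Ventures.LatticeQCDFlow.Scoring

variable {Ω : Type*} [MeasurableSpace Ω] {q : Measure Ω} [IsProbabilityMeasure q] {w : Ω → ℝ}

/-! ## §1 `T ∈ L²` on the pair path law; transfer to replicas -/

/-- `T` is a.e.-strongly measurable on the pair path law (an a.e. limit of the measurable truncated counts). [ours, bookkeeping] -/
theorem crn_chain_totalDisagreement_aestronglyMeasurable [MeasurableEq Ω] (hw : Measurable w) (hw0 : ∀ y, 0 < w y) {x₀ : Ω}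
    (hmax : ∀ y, w y ≤ w x₀) [IsProbabilityMeasure (q.withDensity fun y => ENNReal.ofReal (w y))]
    (Khat : Kernel (Ω × Ω) (Ω × Ω)) [IsMarkovKernel Khat]
    (hK : ∀ z : Ω × Ω, Khat z = (q.prod (volume : Measure unitInterval)).map (fun p : Ω × unitInterval =>
      ((if (p.2 : ℝ) * w z.1 ≤ w p.1 then p.1 else z.1), (if (p.2 : ℝ) * w z.2 ≤ w p.1 then p.1 else z.2))))
    (μ₀ : Measure (Ω × Ω)) [IsProbabilityMeasure μ₀] :
    AEStronglyMeasurable (fun z : ℕ → Ω × Ω => ∑' n, (Set.diagonal Ω)ᶜ.indicator (1 : Ω × Ω → ℝ) (z n))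
      (Kernel.trajMeasure (X := fun _ : ℕ => Ω × Ω) μ₀
        (fun n : ℕ => Khat.comap (fun h : (i : ↥(Finset.Iic n)) → Ω × Ω => h ⟨n, Finset.mem_Iic.2 le_rfl⟩)
          (measurable_pi_apply _))) := by
  have hIm : Measurable ((Set.diagonal Ω)ᶜ.indicator (1 : Ω × Ω → ℝ)) := measurable_one.indicator measurableSet_diagonal.compl
  exact aestronglyMeasurable_of_tendsto_ae atTop
    (fun M => (Finset.measurable_sum _ fun n _ => hIm.comp (measurable_pi_apply n)).aestronglyMeasurable)
    (by
      filter_upwards [crn_chain_ae_tendsto_disagreementCount hw hw0 hmax Khat hK μ₀] with z hz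
      exact hz.2)

/-- **`T ∈ L²(P̂)`** from every initial coupling. [ours, bookkeeping] -/
theorem crn_chain_totalDisagreement_memLp_two [MeasurableEq Ω] [Fact (Measurable w)] (hw0 : ∀ y, 0 < w y) {x₀ : Ω}
    (hmax : ∀ y, w y ≤ w x₀) [IsProbabilityMeasure (q.withDensity fun y => ENNReal.ofReal (w y))]
    (Khat : Kernel (Ω × Ω) (Ω × Ω)) [IsMarkovKernel Khat]
    (hK : ∀ z : Ω × Ω, Khat z = (q.prod (volume : Measure unitInterval)).map (fun p : Ω × unitInterval =>
      ((if (p.2 : ℝ) * w z.1 ≤ w p.1 then p.1 else z.1), (if (p.2 : ℝ) * w z.2 ≤ w p.1 then p.1 else z.2))))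
    (μ₀ : Measure (Ω × Ω)) [IsProbabilityMeasure μ₀] :
    MemLp (fun z : ℕ → Ω × Ω => ∑' n, (Set.diagonal Ω)ᶜ.indicator (1 : Ω × Ω → ℝ) (z n)) 2
      (Kernel.trajMeasure (X := fun _ : ℕ => Ω × Ω) μ₀
        (fun n : ℕ => Khat.comap (fun h : (i : ↥(Finset.Iic n)) → Ω × Ω => h ⟨n, Finset.mem_Iic.2 le_rfl⟩)
          (measurable_pi_apply _))) :=
  (memLp_two_iff_integrable_sq (crn_chain_totalDisagreement_aestronglyMeasurable Fact.out hw0 hmax Khat hK μ₀)).2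
    (crn_chain_totalDisagreement_sq_integrable hw0 hmax Khat hK μ₀)

section Replicas

variable {Ω' : Type*} {mΩ' : MeasurableSpace Ω'} {μ : Measure Ω'} [IsProbabilityMeasure μ]
  {Z : ℕ → Ω' → (ℕ → Ω × Ω)}

omit [IsProbabilityMeasure μ] in
/-- A replica's meeting time is in `L²(μ)`, transferred along the law. [ours, bookkeeping] -/
theorem memLp_totalDisagreement_replica [MeasurableEq Ω] [Fact (Measurable w)] (hw0 : ∀ y, 0 < w y) {x₀ : Ω}
    (hmax : ∀ y, w y ≤ w x₀) [IsProbabilityMeasure (q.withDensity fun y => ENNReal.ofReal (w y))]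
    (Khat : Kernel (Ω × Ω) (Ω × Ω)) [IsMarkovKernel Khat]
    (hK : ∀ z : Ω × Ω, Khat z = (q.prod (volume : Measure unitInterval)).map (fun p : Ω × unitInterval =>
      ((if (p.2 : ℝ) * w z.1 ≤ w p.1 then p.1 else z.1), (if (p.2 : ℝ) * w z.2 ≤ w p.1 then p.1 else z.2))))
    (ν : Measure (Ω × Ω)) [IsProbabilityMeasure ν] (hZm : ∀ j, Measurable (Z j)) {j : ℕ}
    (hlaw : μ.map (Z j) = Kernel.trajMeasure (X := fun _ : ℕ => Ω × Ω) ν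
      (fun n : ℕ => Khat.comap (fun h : (i : ↥(Finset.Iic n)) → Ω × Ω => h ⟨n, Finset.mem_Iic.2 le_rfl⟩)
        (measurable_pi_apply _))) :
    MemLp (fun ω => ∑' n, (Set.diagonal Ω)ᶜ.indicator (1 : Ω × Ω → ℝ) (Z j ω n)) 2 μ := by
  have h := crn_chain_totalDisagreement_memLp_two hw0 hmax Khat hK ν
  rw [← hlaw] at h
  exact (memLp_map_measure_iff h.aestronglyMeasurable (hZm j).aemeasurable).1 h

omit [IsProbabilityMeasure μ] in
/-- The meeting times of streams with the common law of the pair chain are identically distributed. [ours, bookkeeping] -/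
theorem totalDisagreement_replicas_identDistrib [MeasurableEq Ω] (hw : Measurable w) (hw0 : ∀ y, 0 < w y) {x₀ : Ω}
    (hmax : ∀ y, w y ≤ w x₀) [IsProbabilityMeasure (q.withDensity fun y => ENNReal.ofReal (w y))]
    (Khat : Kernel (Ω × Ω) (Ω × Ω)) [IsMarkovKernel Khat]
    (hK : ∀ z : Ω × Ω, Khat z = (q.prod (volume : Measure unitInterval)).map (fun p : Ω × unitInterval =>
      ((if (p.2 : ℝ) * w z.1 ≤ w p.1 then p.1 else z.1), (if (p.2 : ℝ) * w z.2 ≤ w p.1 then p.1 else z.2))))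
    (ν : Measure (Ω × Ω)) [IsProbabilityMeasure ν] (hZm : ∀ j, Measurable (Z j))
    (hlaw : ∀ j, μ.map (Z j) = Kernel.trajMeasure (X := fun _ : ℕ => Ω × Ω) ν
      (fun n : ℕ => Khat.comap (fun h : (i : ↥(Finset.Iic n)) → Ω × Ω => h ⟨n, Finset.mem_Iic.2 le_rfl⟩)
        (measurable_pi_apply _))) (j : ℕ) :
    IdentDistrib (fun ω => ∑' n, (Set.diagonal Ω)ᶜ.indicator (1 : Ω × Ω → ℝ) (Z j ω n))
      (fun ω => ∑' n, (Set.diagonal Ω)ᶜ.indicator (1 : Ω × Ω → ℝ) (Z 0 ω n)) μ μ := by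
  have hasm : ∀ j, AEStronglyMeasurable (fun z : ℕ → Ω × Ω => ∑' n, (Set.diagonal Ω)ᶜ.indicator (1 : Ω × Ω → ℝ) (z n)) (μ.map (Z j)) :=
    fun j => by rw [hlaw j]; exact crn_chain_totalDisagreement_aestronglyMeasurable hw hw0 hmax Khat hK ν
  refine ⟨(hasm j).aemeasurable.comp_measurable (hZm j), (hasm 0).aemeasurable.comp_measurable (hZm 0), ?_⟩
  change μ.map ((fun z : ℕ → Ω × Ω => ∑' n, (Set.diagonal Ω)ᶜ.indicator (1 : Ω × Ω → ℝ) (z n)) ∘ Z j) =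
    μ.map ((fun z : ℕ → Ω × Ω => ∑' n, (Set.diagonal Ω)ᶜ.indicator (1 : Ω × Ω → ℝ) (z n)) ∘ Z 0)
  rw [← AEMeasurable.map_map_of_aemeasurable (hasm j).aemeasurable (hZm j).aemeasurable,
    ← AEMeasurable.map_map_of_aemeasurable (hasm 0).aemeasurable (hZm 0).aemeasurable, hlaw j, hlaw 0]

omit [IsProbabilityMeasure μ] in
/-- Pairwise independent streams give pairwise independent meeting times (a fixed measurable modification of the a.e.-defined `tsum`).
[ours, bookkeeping] -/
theorem totalDisagreement_replicas_indepFun [MeasurableEq Ω] (hw : Measurable w) (hw0 : ∀ y, 0 < w y) {x₀ : Ω}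
    (hmax : ∀ y, w y ≤ w x₀) [IsProbabilityMeasure (q.withDensity fun y => ENNReal.ofReal (w y))]
    (Khat : Kernel (Ω × Ω) (Ω × Ω)) [IsMarkovKernel Khat]
    (hK : ∀ z : Ω × Ω, Khat z = (q.prod (volume : Measure unitInterval)).map (fun p : Ω × unitInterval =>
      ((if (p.2 : ℝ) * w z.1 ≤ w p.1 then p.1 else z.1), (if (p.2 : ℝ) * w z.2 ≤ w p.1 then p.1 else z.2))))
    (ν : Measure (Ω × Ω)) [IsProbabilityMeasure ν] (hZm : ∀ j, Measurable (Z j))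
    (hlaw : ∀ j, μ.map (Z j) = Kernel.trajMeasure (X := fun _ : ℕ => Ω × Ω) ν
      (fun n : ℕ => Khat.comap (fun h : (i : ↥(Finset.Iic n)) → Ω × Ω => h ⟨n, Finset.mem_Iic.2 le_rfl⟩)
        (measurable_pi_apply _))) (hind : Pairwise ((· ⟂ᵢ[μ] ·) on Z)) :
    Pairwise ((· ⟂ᵢ[μ] ·) on fun j ω => ∑' n, (Set.diagonal Ω)ᶜ.indicator (1 : Ω × Ω → ℝ) (Z j ω n)) := by
  obtain ⟨g, hgm, hgae⟩ := crn_chain_totalDisagreement_aestronglyMeasurable hw hw0 hmax Khat hK ν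
  intro i j hij
  have hg : IndepFun (fun ω => g (Z i ω)) (fun ω => g (Z j ω)) μ := (hind hij).comp hgm.measurable hgm.measurable
  refine hg.congr ?_ ?_
  · have hae : (fun z : ℕ → Ω × Ω => ∑' n, (Set.diagonal Ω)ᶜ.indicator (1 : Ω × Ω → ℝ) (z n)) =ᵐ[μ.map (Z i)] g := by rw [hlaw i]; exact hgae
    exact (ae_eq_comp (hZm i).aemeasurable hae).symm
  · have hae : (fun z : ℕ → Ω × Ω => ∑' n, (Set.diagonal Ω)ᶜ.indicator (1 : Ω × Ω → ℝ) (z n)) =ᵐ[μ.map (Z j)] g := by rw [hlaw j]; exact hgae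
    exact (ae_eq_comp (hZm j).aemeasurable hae).symm

/-! ## §2 The mean-square error of the printed mean meeting time, and Chebyshev -/

/-- **`E(T̄_R − E T)² ≤ p₀W(2W − 1)/R`** for pairwise independent streams with the common law of the pair chain, `R ≥ 1`
(`T̄_R = replicaMean`, `E T = ∫ T dP̂`). [ours] -/
theorem replicas_meetingTime_sq_le [MeasurableEq Ω] [Fact (Measurable w)] (hw0 : ∀ y, 0 < w y) {x₀ : Ω}
    (hmax : ∀ y, w y ≤ w x₀) [IsProbabilityMeasure (q.withDensity fun y => ENNReal.ofReal (w y))]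
    (Khat : Kernel (Ω × Ω) (Ω × Ω)) [IsMarkovKernel Khat]
    (hK : ∀ z : Ω × Ω, Khat z = (q.prod (volume : Measure unitInterval)).map (fun p : Ω × unitInterval =>
      ((if (p.2 : ℝ) * w z.1 ≤ w p.1 then p.1 else z.1), (if (p.2 : ℝ) * w z.2 ≤ w p.1 then p.1 else z.2))))
    (ν : Measure (Ω × Ω)) [IsProbabilityMeasure ν] (hZm : ∀ j, Measurable (Z j))
    (hlaw : ∀ j, μ.map (Z j) = Kernel.trajMeasure (X := fun _ : ℕ => Ω × Ω) ν
      (fun n : ℕ => Khat.comap (fun h : (i : ↥(Finset.Iic n)) → Ω × Ω => h ⟨n, Finset.mem_Iic.2 le_rfl⟩)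
        (measurable_pi_apply _))) (hind : Pairwise ((· ⟂ᵢ[μ] ·) on Z)) {R : ℕ} (hR : 1 ≤ R) :
    ∫ ω, (replicaMean (fun j ω => ∑' n, (Set.diagonal Ω)ᶜ.indicator (1 : Ω × Ω → ℝ) (Z j ω n)) R ω -
        ∫ z, (∑' n, (Set.diagonal Ω)ᶜ.indicator (1 : Ω × Ω → ℝ) (z n))
          ∂(Kernel.trajMeasure (X := fun _ : ℕ => Ω × Ω) ν
            (fun n : ℕ => Khat.comap (fun h : (i : ↥(Finset.Iic n)) → Ω × Ω => h ⟨n, Finset.mem_Iic.2 le_rfl⟩)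
              (measurable_pi_apply _)))) ^ 2 ∂μ ≤
      ν.real (Set.diagonal Ω)ᶜ * (w x₀ * (2 * w x₀ - 1)) / R := by
  have hw : Measurable w := Fact.out
  set P := Kernel.trajMeasure (X := fun _ : ℕ => Ω × Ω) ν
      (fun n : ℕ => Khat.comap (fun h : (i : ↥(Finset.Iic n)) → Ω × Ω => h ⟨n, Finset.mem_Iic.2 le_rfl⟩)
        (measurable_pi_apply _)) with hP
  set T : (ℕ → Ω × Ω) → ℝ := fun z => ∑' n, (Set.diagonal Ω)ᶜ.indicator (1 : Ω × Ω → ℝ) (z n) with hT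
  set m := ∫ z, T z ∂P with hm
  have hasm : ∀ j, AEStronglyMeasurable T (μ.map (Z j)) := fun j => by
    rw [hlaw j]; exact crn_chain_totalDisagreement_aestronglyMeasurable hw hw0 hmax Khat hK ν
  have hX2 : ∀ j, MemLp (fun ω => T (Z j ω)) 2 μ := fun j => memLp_totalDisagreement_replica hw0 hmax Khat hK ν hZm (hlaw j)
  have hindT := totalDisagreement_replicas_indepFun hw hw0 hmax Khat hK ν hZm hlaw hind
  -- every replica has mean `m` and second moment about `m` at most `p₀W(2W − 1)`
  have hmean : ∀ j, μ[fun ω => T (Z j ω)] = m := fun j => by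
    rw [← integral_map (hZm j).aemeasurable (hasm j), hlaw j]
  have hsq : ∀ j, ∫ ω, (T (Z j ω) - m) ^ 2 ∂μ ≤ ν.real (Set.diagonal Ω)ᶜ * (w x₀ * (2 * w x₀ - 1)) := by
    intro j
    have h1 := integral_sub_const_sq (hX2 j) m
    rw [hmean j, sub_self, zero_pow two_ne_zero, add_zero] at h1
    -- `Var ≤ E T²`, transferred along the law, `≤ p₀W(2W − 1)` by GEN-38
    have hvar : Var[fun ω => T (Z j ω); μ] ≤ ∫ ω, (T (Z j ω)) ^ 2 ∂μ := by
      have h2 := integral_sub_const_sq (hX2 j) 0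
      simp only [sub_zero] at h2
      rw [h2]; nlinarith [sq_nonneg (μ[fun ω => T (Z j ω)])]
    have hsqT : AEStronglyMeasurable (fun z : ℕ → Ω × Ω => T z ^ 2) (μ.map (Z j)) := by
      rw [hlaw j]; exact (crn_chain_totalDisagreement_sq_integrable hw0 hmax Khat hK ν).aestronglyMeasurable
    have h3 : ∫ ω, (T (Z j ω)) ^ 2 ∂μ ≤ ν.real (Set.diagonal Ω)ᶜ * (w x₀ * (2 * w x₀ - 1)) := by
      rw [← integral_map (hZm j).aemeasurable hsqT, hlaw j]
      exact crn_chain_integral_totalDisagreement_sq_le hw0 hmax Khat hK ν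
    rw [h1]; exact hvar.trans h3
  have hcov : ∀ i < R, ∀ j < R, i ≠ j → cov[fun ω => T (Z i ω), fun ω => T (Z j ω); μ] = 0 :=
    fun i _ j _ hij => (hindT hij).covariance_eq_zero (hX2 i) (hX2 j)
  have hRne : R ≠ 0 := by omega
  have h := integral_replicaMean_sub_sq_le (μ := μ) (Y := fun j ω => T (Z j ω)) (R := R) hRne (fun j _ => hX2 j) hcov
    (c := m) (b := 0) (v := ν.real (Set.diagonal Ω)ᶜ * (w x₀ * (2 * w x₀ - 1)))
    (fun j _ => by rw [hmean j, sub_self, abs_zero]) (fun j _ => hsq j)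
  simpa using h

/-- **CHEBYSHEV FOR THE PRINTED MEAN MEETING TIME**: `P(|T̄_R − E T| ≥ s) ≤ p₀W(2W − 1)/(R s²)` (`s > 0`, `R ≥ 1`, pairwise independent
streams). [ours] -/
theorem replicas_meetingTime_chebyshev [MeasurableEq Ω] [Fact (Measurable w)] (hw0 : ∀ y, 0 < w y) {x₀ : Ω}
    (hmax : ∀ y, w y ≤ w x₀) [IsProbabilityMeasure (q.withDensity fun y => ENNReal.ofReal (w y))]
    (Khat : Kernel (Ω × Ω) (Ω × Ω)) [IsMarkovKernel Khat]
    (hK : ∀ z : Ω × Ω, Khat z = (q.prod (volume : Measure unitInterval)).map (fun p : Ω × unitInterval =>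
      ((if (p.2 : ℝ) * w z.1 ≤ w p.1 then p.1 else z.1), (if (p.2 : ℝ) * w z.2 ≤ w p.1 then p.1 else z.2))))
    (ν : Measure (Ω × Ω)) [IsProbabilityMeasure ν] (hZm : ∀ j, Measurable (Z j))
    (hlaw : ∀ j, μ.map (Z j) = Kernel.trajMeasure (X := fun _ : ℕ => Ω × Ω) ν
      (fun n : ℕ => Khat.comap (fun h : (i : ↥(Finset.Iic n)) → Ω × Ω => h ⟨n, Finset.mem_Iic.2 le_rfl⟩)
        (measurable_pi_apply _))) (hind : Pairwise ((· ⟂ᵢ[μ] ·) on Z)) {R : ℕ} (hR : 1 ≤ R) {s : ℝ} (hs : 0 < s) :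
    μ.real {ω | s ≤ |replicaMean (fun j ω => ∑' n, (Set.diagonal Ω)ᶜ.indicator (1 : Ω × Ω → ℝ) (Z j ω n)) R ω -
        ∫ z, (∑' n, (Set.diagonal Ω)ᶜ.indicator (1 : Ω × Ω → ℝ) (z n))
          ∂(Kernel.trajMeasure (X := fun _ : ℕ => Ω × Ω) ν
            (fun n : ℕ => Khat.comap (fun h : (i : ↥(Finset.Iic n)) → Ω × Ω => h ⟨n, Finset.mem_Iic.2 le_rfl⟩)
              (measurable_pi_apply _)))|} ≤
      ν.real (Set.diagonal Ω)ᶜ * (w x₀ * (2 * w x₀ - 1)) / R / s ^ 2 := by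
  have hX2 : ∀ j < R, MemLp (fun ω => ∑' n, (Set.diagonal Ω)ᶜ.indicator (1 : Ω × Ω → ℝ) (Z j ω n)) 2 μ :=
    fun j _ => memLp_totalDisagreement_replica hw0 hmax Khat hK ν hZm (hlaw j)
  refine (measureReal_abs_sub_ge_le (memLp_replicaMean hX2) _ hs).trans ?_
  exact div_le_div_of_nonneg_right (replicas_meetingTime_sq_le hw0 hmax Khat hK ν hZm hlaw hind hR) (sq_nonneg _)

/-! ## §3 The strong law for the printed mean meeting time -/

/-- **`T̄_R → E T` ALMOST SURELY** for pairwise independent streams with the common law of the pair chain (Mathlib's strong law applied). [ours] -/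
theorem replicas_meetingTime_strongLaw [MeasurableEq Ω] [Fact (Measurable w)] (hw0 : ∀ y, 0 < w y) {x₀ : Ω}
    (hmax : ∀ y, w y ≤ w x₀) [IsProbabilityMeasure (q.withDensity fun y => ENNReal.ofReal (w y))]
    (Khat : Kernel (Ω × Ω) (Ω × Ω)) [IsMarkovKernel Khat]
    (hK : ∀ z : Ω × Ω, Khat z = (q.prod (volume : Measure unitInterval)).map (fun p : Ω × unitInterval =>
      ((if (p.2 : ℝ) * w z.1 ≤ w p.1 then p.1 else z.1), (if (p.2 : ℝ) * w z.2 ≤ w p.1 then p.1 else z.2))))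
    (ν : Measure (Ω × Ω)) [IsProbabilityMeasure ν] (hZm : ∀ j, Measurable (Z j))
    (hlaw : ∀ j, μ.map (Z j) = Kernel.trajMeasure (X := fun _ : ℕ => Ω × Ω) ν
      (fun n : ℕ => Khat.comap (fun h : (i : ↥(Finset.Iic n)) → Ω × Ω => h ⟨n, Finset.mem_Iic.2 le_rfl⟩)
        (measurable_pi_apply _))) (hind : Pairwise ((· ⟂ᵢ[μ] ·) on Z)) :
    ∀ᵐ ω ∂μ, Tendsto (fun R : ℕ => (R : ℝ)⁻¹ * ∑ j ∈ range R, ∑' n, (Set.diagonal Ω)ᶜ.indicator (1 : Ω × Ω → ℝ) (Z j ω n)) atTop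
      (𝓝 (∫ z, (∑' n, (Set.diagonal Ω)ᶜ.indicator (1 : Ω × Ω → ℝ) (z n))
        ∂(Kernel.trajMeasure (X := fun _ : ℕ => Ω × Ω) ν
          (fun n : ℕ => Khat.comap (fun h : (i : ↥(Finset.Iic n)) → Ω × Ω => h ⟨n, Finset.mem_Iic.2 le_rfl⟩)
            (measurable_pi_apply _))))) := by
  have hw : Measurable w := Fact.out
  have hasm : AEStronglyMeasurable (fun z : ℕ → Ω × Ω => ∑' n, (Set.diagonal Ω)ᶜ.indicator (1 : Ω × Ω → ℝ) (z n)) (μ.map (Z 0)) := by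
    rw [hlaw 0]; exact crn_chain_totalDisagreement_aestronglyMeasurable hw hw0 hmax Khat hK ν
  have hint : Integrable (fun ω => ∑' n, (Set.diagonal Ω)ᶜ.indicator (1 : Ω × Ω → ℝ) (Z 0 ω n)) μ :=
    (memLp_totalDisagreement_replica hw0 hmax Khat hK ν hZm (hlaw 0)).integrable one_le_two
  have hmean : μ[fun ω => ∑' n, (Set.diagonal Ω)ᶜ.indicator (1 : Ω × Ω → ℝ) (Z 0 ω n)] =
      ∫ z, (∑' n, (Set.diagonal Ω)ᶜ.indicator (1 : Ω × Ω → ℝ) (z n))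
        ∂(Kernel.trajMeasure (X := fun _ : ℕ => Ω × Ω) ν
          (fun n : ℕ => Khat.comap (fun h : (i : ↥(Finset.Iic n)) → Ω × Ω => h ⟨n, Finset.mem_Iic.2 le_rfl⟩)
            (measurable_pi_apply _))) := by
    rw [← integral_map (hZm 0).aemeasurable hasm, hlaw 0]
  have h := strong_law_ae (fun j ω => ∑' n, (Set.diagonal Ω)ᶜ.indicator (1 : Ω × Ω → ℝ) (Z j ω n)) hint
    (totalDisagreement_replicas_indepFun hw hw0 hmax Khat hK ν hZm hlaw hind) (totalDisagreement_replicas_identDistrib hw hw0 hmax Khat hK ν hZm hlaw)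
  rw [hmean] at h
  filter_upwards [h] with ω hω
  simpa only [smul_eq_mul] using hω

/-- **FROM (COLD, OFF-MODE): `T̄_R → W = 1/A` ALMOST SURELY** (atom-free proposal) — the observed mean meeting time of coupled cold/hot pairs is a
consistent estimator of the inverse cold acceptance. [ours] -/
theorem replicas_meetingTime_strongLaw_cold [MeasurableSingletonClass Ω] [MeasurableEq Ω] [Fact (Measurable w)] (hw0 : ∀ y, 0 < w y)
    {x₀ : Ω} (hmax : ∀ y, w y ≤ w x₀) [IsProbabilityMeasure (q.withDensity fun y => ENNReal.ofReal (w y))] (hq0 : q {x₀} = 0)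
    (Khat : Kernel (Ω × Ω) (Ω × Ω)) [IsMarkovKernel Khat]
    (hK : ∀ z : Ω × Ω, Khat z = (q.prod (volume : Measure unitInterval)).map (fun p : Ω × unitInterval =>
      ((if (p.2 : ℝ) * w z.1 ≤ w p.1 then p.1 else z.1), (if (p.2 : ℝ) * w z.2 ≤ w p.1 then p.1 else z.2))))
    (ν : Measure (Ω × Ω)) [IsProbabilityMeasure ν] (hfst : ν.map Prod.fst = Measure.dirac x₀) (hsnd : (ν.map Prod.snd) {x₀} = 0)
    (hZm : ∀ j, Measurable (Z j))
    (hlaw : ∀ j, μ.map (Z j) = Kernel.trajMeasure (X := fun _ : ℕ => Ω × Ω) ν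
      (fun n : ℕ => Khat.comap (fun h : (i : ↥(Finset.Iic n)) → Ω × Ω => h ⟨n, Finset.mem_Iic.2 le_rfl⟩)
        (measurable_pi_apply _))) (hind : Pairwise ((· ⟂ᵢ[μ] ·) on Z)) :
    ∀ᵐ ω ∂μ, Tendsto (fun R : ℕ => (R : ℝ)⁻¹ * ∑ j ∈ range R, ∑' n, (Set.diagonal Ω)ᶜ.indicator (1 : Ω × Ω → ℝ) (Z j ω n)) atTop
      (𝓝 (w x₀)) := by
  have h := replicas_meetingTime_strongLaw hw0 hmax Khat hK ν hZm hlaw hind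
  rwa [crn_chain_integral_totalDisagreement_eq_cold Fact.out hw0 hmax hq0 Khat hK ν hfst hsnd] at h

end Replicas

end Summit.Ventures.LatticeQCDFlow.Exactness

end
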